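import Summits.CriticalPhenomena.PercolationContinuityZ3.Theorems.PercNearOneGluingNoHeavyQuantFarTreeBlockCombHair
import Summits.CriticalPhenomena.PercolationContinuityZ3.Theorems.PercNearOneGluingNoHeavyQuantFarRelayRowBlockCombMean
import HarnessLib

/-!
# QUANT lane R8, FAR on trees beyond block-combs: BLOCK-COMB + ONE TWO-RELAY HAIR, route vocabulary
# (`Quant.farRelayRow_tree_blockComb_hair` — the body of `Quant.FarRelayRow` for this family, every layer)

builds on p205010 (kernel theorem, internal audit signed; external expert review pending)

Support file (`--supports stmt-CriticalPhenomena-4575`), QUANT lane typer seat prim-quant-stmt (gen 16); census-1 g13's transport ask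
(lane INBOX 2026-08-21T05:12Z (ii)).  Theorems only, no sorries, standard axioms.  The route-vocabulary wrapper of
`Quant.BlockCombGate.farTree_blockComb_hair` (`…QuantFarTreeBlockCombHair.lean`, same seat; canonical row: census-1 g13's
`Quant.BlockComb.tail_ge_of_mean_hair`, p248279), following census-1 g13's `Quant.farRelayRow_tree_blockComb_of_mean`
(`…QuantFarRelayRowBlockCombMean.lean`): tree-supported weights on `Sym2 (Fin n)` (`Quant.tree_relayCount_transfer`), a block-comb
presentation of the classes (chain `ch`, classes `R k` with private vertex sets `G k`, levels `lv k`), and a HAIR: two further relays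
`b₁, b₂ ∈ A` with root paths `ch''{i<l} ∪ {b₁}` and `ch''{i<l} ∪ {b₁, b₂}` (a unit relay hanging at the chain vertex of level `l`, a unit
relay below it).  The spare indices of the gate-coordinate theorem are supplied here (`Option (Option κ)`), so the statement quantifies over
an honest class index type `κ`.

* `Quant.farRelayRow_tree_blockComb_hair` — **FAR at every layer, route vocabulary, for every tree-supported weight whose relay set is
  covered by a block-comb presentation plus one two-relay hair**: `2j < Σ_{b∈A} P(o ↔ b)` and `P(o ↮ b) ≤ t` on `A` give
  `P(#{b ∈ A | o ↔ b} ≤ j) ≤ t`.  No strong / tied / class hypothesis; the first kernel family of `Quant.FarRelayRow` beyond block-combs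
  (LEAD-NOTES-G14 N25 (1): 'block-comb + one two-relay hair at the root' is the instance `l = 0`).
[cite: KozmaNitzan2024, Lemma 2 (p. 6), Conjecture 3 (p. 15)]; the family theorem is [this work].
-/

noncomputable section

namespace Summit.CriticalPhenomena.PercolationContinuityZ3.Theorems

namespace Quant

open Finset MeasureTheory
open Literature.Probability.LatticeModels
open Literature.Probability.Percolation
open scoped Classical

variable {n : ℕ}

/-- **FAR at every layer for BLOCK-COMB + ONE TWO-RELAY HAIR, route vocabulary, under FAR's own hypothesis.**  Tree-supported weights `w`
on `Sym2 (Fin n)` (root `o`, coordinates `par`/`depth`, `hsupp`), relays `A ∌ o`; a block-comb presentation (`ch` injective, classes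
`R k ⊆ A` pairwise disjoint with private vertex sets `G k` pairwise disjoint and off the chain, `lv k ≤ D`, root path of every
`b ∈ R k` equal to `ch''{i < lv k} ∪ G k`) and a HAIR at chain level `l ≤ D`: relays `b₁ ≠ b₂` in `A`, off the chain and the private
sets, with root paths `ch''{i<l} ∪ {b₁}` and `ch''{i<l} ∪ {b₁, b₂}`; `A` is covered by the classes and the hair, and some relay sees the
whole chain (a nonempty class at level `D`, or `l = D`).  If `2j < Σ_{b∈A} P(o ↔ b)` and `P(o ↮ b) ≤ t` for all `b ∈ A`, then
`P(#{b ∈ A | o ↔ b} ≤ j) ≤ t`. [this work] -/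
theorem farRelayRow_tree_blockComb_hair (n : ℕ) (w : Sym2 (Fin n) → unitInterval) (o : Fin n)
    (depth : Fin n → ℕ) (par : Fin n → Fin n)
    (hroot : ∀ x, x ≠ o → depth x = 0 → par x = o)
    (hstep : ∀ x, x ≠ o → depth x ≠ 0 → par x ≠ o ∧ depth (par x) + 1 = depth x)
    (hsupp : ∀ e, w e ≠ 0 → e.IsDiag ∨ ∃ x, x ≠ o ∧ e = s(par x, x))
    (A : Finset (Fin n)) (hoA : o ∉ A) (j : ℕ) (t : ℝ)
    {κ : Type*} [Fintype κ] [DecidableEq κ]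
    (D : ℕ) (ch : Fin D → Fin n) (hch : Function.Injective ch)
    (G : κ → Finset (Fin n)) (hGdisj : ∀ k k', k ≠ k' → Disjoint (G k) (G k')) (hGch : ∀ k (i : Fin D), ch i ∉ G k)
    (R : κ → Finset (Fin n)) (hRA : ∀ k, R k ⊆ A) (hRdisj : ∀ k k', k ≠ k' → Disjoint (R k) (R k'))
    (lv : κ → ℕ) (hlv : ∀ k, lv k ≤ D)
    (hpath : ∀ k, ∀ b ∈ R k, (Finset.range (depth b + 1)).image (fun i => par^[i] b) =
      ((Finset.univ : Finset (Fin D)).filter (fun i : Fin D => i.val < lv k)).image ch ∪ G k)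
    (b₁ b₂ : Fin n) (hb₁A : b₁ ∈ A) (hb₂A : b₂ ∈ A) (hb : b₁ ≠ b₂) (l : ℕ) (hl : l ≤ D)
    (hb₁ch : ∀ i : Fin D, ch i ≠ b₁) (hb₂ch : ∀ i : Fin D, ch i ≠ b₂) (hb₁G : ∀ k, b₁ ∉ G k) (hb₂G : ∀ k, b₂ ∉ G k)
    (hpath₁ : (Finset.range (depth b₁ + 1)).image (fun i => par^[i] b₁) =
      insert b₁ (((Finset.univ : Finset (Fin D)).filter (fun i : Fin D => i.val < l)).image ch))
    (hpath₂ : (Finset.range (depth b₂ + 1)).image (fun i => par^[i] b₂) =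
      insert b₂ (insert b₁ (((Finset.univ : Finset (Fin D)).filter (fun i : Fin D => i.val < l)).image ch)))
    (hcover : ∀ b ∈ A, b = b₁ ∨ b = b₂ ∨ ∃ k, b ∈ R k)
    (hdeep : (∃ k, (R k).Nonempty ∧ lv k = D) ∨ l = D)
    (hEN : (2 * j : ℝ) < ∑ b ∈ A, (prodBernoulli w).real (openConn o b))
    (ht : ∀ b ∈ A, (prodBernoulli w).real (openConn o b : Set (BondConfig (Fin n)))ᶜ ≤ t) :
    (prodBernoulli w).real {ω : BondConfig (Fin n) | (A.filter fun b => ω ∈ openConn o b).card ≤ j} ≤ t := by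
  rw [tree_relayCount_transfer n w o depth par hroot hstep hsupp A j]
  set q : Fin n → unitInterval := fun x => if x = o then 1 else w s(par x, x) with hq
  have hqy : ∀ y, y ≠ o → q y = w s(par y, y) := fun y hy => by simp only [hq, if_neg hy]
  have hAo : ∀ b ∈ A, b ≠ o := fun b hb hbo => hoA (hbo ▸ hb)
  -- the hair relays are in no class
  have hb₁R : ∀ k, b₁ ∉ R k := by
    intro k hk
    have hmem : b₁ ∈ (Finset.range (depth b₁ + 1)).image (fun i => par^[i] b₁) :=
      Finset.mem_image.2 ⟨0, Finset.mem_range.2 (Nat.succ_pos _), rfl⟩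
    rw [hpath k b₁ hk, Finset.mem_union] at hmem
    rcases hmem with h | h
    · obtain ⟨i, -, hi⟩ := Finset.mem_image.1 h; exact hb₁ch i hi
    · exact hb₁G k h
  have hb₂R : ∀ k, b₂ ∉ R k := by
    intro k hk
    have hmem : b₂ ∈ (Finset.range (depth b₂ + 1)).image (fun i => par^[i] b₂) :=
      Finset.mem_image.2 ⟨0, Finset.mem_range.2 (Nat.succ_pos _), rfl⟩
    rw [hpath k b₂ hk, Finset.mem_union] at hmem
    rcases hmem with h | h
    · obtain ⟨i, -, hi⟩ := Finset.mem_image.1 h; exact hb₂ch i hi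
    · exact hb₂G k h
  -- the extended presentation: spare indices `none` (anchor of the hair) and `some none`
  set G' : Option (Option κ) → Finset (Fin n) := fun k' => k'.elim ∅ fun k'' => k''.elim ∅ G with hG'
  set a' : Option (Option κ) → ℕ := fun k' => k'.elim 0 fun k'' => k''.elim 0 fun k => (R k).card with ha'
  set lv' : Option (Option κ) → ℕ := fun k' => k'.elim l fun k'' => k''.elim l lv with hlv'
  have hG'0 : G' none = ∅ := rfl
  have hG'1 : G' (some none) = ∅ := rfl
  have hG'2 : ∀ k, G' (some (some k)) = G k := fun k => rfl
  have ha'0 : a' none = 0 := rfl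
  have ha'1 : a' (some none) = 0 := rfl
  have ha'2 : ∀ k, a' (some (some k)) = (R k).card := fun k => rfl
  have hlv'0 : lv' none = l := rfl
  have hlv'1 : lv' (some none) = l := rfl
  have hlv'2 : ∀ k, lv' (some (some k)) = lv k := fun k => rfl
  have hGdisj' : ∀ k k', k ≠ k' → Disjoint (G' k) (G' k') := by
    rintro (_ | _ | k) (_ | _ | k') hne <;>
      first
      | exact Finset.disjoint_empty_left _
      | exact Finset.disjoint_empty_right _
      | exact hGdisj k k' fun h => hne (by rw [h])
  have hGch' : ∀ k (i : Fin D), ch i ∉ G' k := by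
    rintro (_ | _ | k) i
    · exact Finset.notMem_empty _
    · exact Finset.notMem_empty _
    · exact hGch k i
  have hlvle' : ∀ k, lv' k ≤ D := by
    rintro (_ | _ | k)
    · exact hl
    · exact hl
    · exact hlv k
  have hG₁' : ∀ k, b₁ ∉ G' k := by
    rintro (_ | _ | k)
    · exact Finset.notMem_empty _
    · exact Finset.notMem_empty _
    · exact hb₁G k
  have hG₂' : ∀ k, b₂ ∉ G' k := by
    rintro (_ | _ | k)
    · exact Finset.notMem_empty _
    · exact Finset.notMem_empty _
    · exact hb₂G k
  -- the gate-coordinate event contains the light relay-count event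
  set F : Set (Set (Fin n)) := {ω' : Set (Fin n) | (∑ k' ∈ Finset.univ.filter
      (fun k' => (∀ i : Fin D, (i : ℕ) < lv' k' → ch i ∈ ω') ∧ ((G' k' : Finset (Fin n)) : Set (Fin n)) ⊆ ω'), a' k') +
      (if (∀ i : Fin D, (i : ℕ) < lv' none → ch i ∈ ω') ∧ b₁ ∈ ω' then 1 else 0) +
      (if (∀ i : Fin D, (i : ℕ) < lv' none → ch i ∈ ω') ∧ b₁ ∈ ω' ∧ b₂ ∈ ω' then 1 else 0) ≤ j} with hF
  have hsub : {ω' : Set (Fin n) | (A.filter fun a => a = o ∨ ∀ i, i ≤ depth a → par^[i] a ∈ ω').card ≤ j} ⊆ F := by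
    intro ω' hω'
    have hle : (A.filter fun a => a = o ∨ ∀ i, i ≤ depth a → par^[i] a ∈ ω').card ≤ j := hω'
    show (∑ k' ∈ Finset.univ.filter
      (fun k' => (∀ i : Fin D, (i : ℕ) < lv' k' → ch i ∈ ω') ∧ ((G' k' : Finset (Fin n)) : Set (Fin n)) ⊆ ω'), a' k') +
      (if (∀ i : Fin D, (i : ℕ) < lv' none → ch i ∈ ω') ∧ b₁ ∈ ω' then 1 else 0) +
      (if (∀ i : Fin D, (i : ℕ) < lv' none → ch i ∈ ω') ∧ b₁ ∈ ω' ∧ b₂ ∈ ω' then 1 else 0) ≤ j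
    -- reached classes
    set Kr : Finset κ := Finset.univ.filter
      (fun k => (∀ i : Fin D, (i : ℕ) < lv' (some (some k)) → ch i ∈ ω') ∧
        ((G' (some (some k)) : Finset (Fin n)) : Set (Fin n)) ⊆ ω') with hKr
    have hsumKr : (∑ k' ∈ Finset.univ.filter
        (fun k' => (∀ i : Fin D, (i : ℕ) < lv' k' → ch i ∈ ω') ∧ ((G' k' : Finset (Fin n)) : Set (Fin n)) ⊆ ω'), a' k') =
        ∑ k ∈ Kr, (R k).card := by
      rw [Finset.sum_filter, Fintype.sum_option, Fintype.sum_option, hKr, Finset.sum_filter]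
      simp only [ha'0, ha'1, ha'2, ite_self, zero_add]
    have hreach : ∀ k ∈ Kr, ∀ b ∈ R k, (b = o ∨ ∀ i, i ≤ depth b → par^[i] b ∈ ω') := by
      intro k hk b hb
      obtain ⟨-, hpre, hG⟩ := Finset.mem_filter.1 hk
      rw [hlv'2] at hpre
      rw [hG'2] at hG
      refine Or.inr fun i hi => ?_
      have hmem : par^[i] b ∈ (Finset.range (depth b + 1)).image (fun i => par^[i] b) :=
        Finset.mem_image.2 ⟨i, Finset.mem_range.2 (by omega), rfl⟩
      rw [hpath k b hb, Finset.mem_union] at hmem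
      rcases hmem with h | h
      · obtain ⟨i', hi', he⟩ := Finset.mem_image.1 h
        rw [← he]
        exact hpre i' (Finset.mem_filter.1 hi').2
      · exact hG (Finset.mem_coe.2 h)
    set S₀ : Finset (Fin n) := Kr.biUnion R with hS₀
    have hcard : ∑ k ∈ Kr, (R k).card = S₀.card := by
      rw [hS₀, Finset.card_biUnion]
      intro k _ k' _ hkk'
      exact hRdisj k k' hkk'
    have hS₀sub : S₀ ⊆ A.filter fun a => a = o ∨ ∀ i, i ≤ depth a → par^[i] a ∈ ω' := by
      intro b hb'
      obtain ⟨k, hk, hbk⟩ := Finset.mem_biUnion.1 hb'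
      exact Finset.mem_filter.2 ⟨hRA k hbk, hreach k hk b hbk⟩
    have hb₁S₀ : b₁ ∉ S₀ := fun h => by
      obtain ⟨k, -, hbk⟩ := Finset.mem_biUnion.1 h; exact hb₁R k hbk
    have hb₂S₀ : b₂ ∉ S₀ := fun h => by
      obtain ⟨k, -, hbk⟩ := Finset.mem_biUnion.1 h; exact hb₂R k hbk
    -- the hair relays, when counted, are reached in the tree
    have hTR₁ : (∀ i : Fin D, (i : ℕ) < lv' none → ch i ∈ ω') ∧ b₁ ∈ ω' →
        b₁ ∈ A.filter fun a => a = o ∨ ∀ i, i ≤ depth a → par^[i] a ∈ ω' := by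
      rintro ⟨hpre, h1⟩
      refine Finset.mem_filter.2 ⟨hb₁A, Or.inr fun i hi => ?_⟩
      have hmem : par^[i] b₁ ∈ (Finset.range (depth b₁ + 1)).image (fun i => par^[i] b₁) :=
        Finset.mem_image.2 ⟨i, Finset.mem_range.2 (by omega), rfl⟩
      rw [hpath₁, Finset.mem_insert] at hmem
      rcases hmem with h | h
      · rw [h]; exact h1
      · obtain ⟨i', hi', he⟩ := Finset.mem_image.1 h
        rw [← he]
        exact hpre i' (Finset.mem_filter.1 hi').2
    have hTR₂ : (∀ i : Fin D, (i : ℕ) < lv' none → ch i ∈ ω') ∧ b₁ ∈ ω' ∧ b₂ ∈ ω' →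
        b₂ ∈ A.filter fun a => a = o ∨ ∀ i, i ≤ depth a → par^[i] a ∈ ω' := by
      rintro ⟨hpre, h1, h2⟩
      refine Finset.mem_filter.2 ⟨hb₂A, Or.inr fun i hi => ?_⟩
      have hmem : par^[i] b₂ ∈ (Finset.range (depth b₂ + 1)).image (fun i => par^[i] b₂) :=
        Finset.mem_image.2 ⟨i, Finset.mem_range.2 (by omega), rfl⟩
      rw [hpath₂, Finset.mem_insert, Finset.mem_insert] at hmem
      rcases hmem with h | h | h
      · rw [h]; exact h2
      · rw [h]; exact h1
      · obtain ⟨i', hi', he⟩ := Finset.mem_image.1 h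
        rw [← he]
        exact hpre i' (Finset.mem_filter.1 hi').2
    rw [hsumKr, hcard]
    by_cases h1 : (∀ i : Fin D, (i : ℕ) < lv' none → ch i ∈ ω') ∧ b₁ ∈ ω'
    · by_cases h2 : (∀ i : Fin D, (i : ℕ) < lv' none → ch i ∈ ω') ∧ b₁ ∈ ω' ∧ b₂ ∈ ω'
      · rw [if_pos h1, if_pos h2]
        have hsub2 : insert b₂ (insert b₁ S₀) ⊆ A.filter fun a => a = o ∨ ∀ i, i ≤ depth a → par^[i] a ∈ ω' :=
          Finset.insert_subset (hTR₂ h2) (Finset.insert_subset (hTR₁ h1) hS₀sub)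
        have hc2 : (insert b₂ (insert b₁ S₀)).card = S₀.card + 1 + 1 := by
          rw [Finset.card_insert_of_notMem (by rw [Finset.mem_insert, not_or]; exact ⟨hb.symm, hb₂S₀⟩),
            Finset.card_insert_of_notMem hb₁S₀]
        calc S₀.card + 1 + 1 = (insert b₂ (insert b₁ S₀)).card := hc2.symm
          _ ≤ (A.filter fun a => a = o ∨ ∀ i, i ≤ depth a → par^[i] a ∈ ω').card := Finset.card_le_card hsub2
          _ ≤ j := hle
      · rw [if_pos h1, if_neg h2, add_zero]
        have hsub1 : insert b₁ S₀ ⊆ A.filter fun a => a = o ∨ ∀ i, i ≤ depth a → par^[i] a ∈ ω' :=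
          Finset.insert_subset (hTR₁ h1) hS₀sub
        calc S₀.card + 1 = (insert b₁ S₀).card := (Finset.card_insert_of_notMem hb₁S₀).symm
          _ ≤ (A.filter fun a => a = o ∨ ∀ i, i ≤ depth a → par^[i] a ∈ ω').card := Finset.card_le_card hsub1
          _ ≤ j := hle
    · have h2 : ¬ ((∀ i : Fin D, (i : ℕ) < lv' none → ch i ∈ ω') ∧ b₁ ∈ ω' ∧ b₂ ∈ ω') :=
        fun h => h1 ⟨h.1, h.2.1⟩
      rw [if_neg h1, if_neg h2, add_zero, add_zero]
      exact (Finset.card_le_card hS₀sub).trans hle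
  refine le_trans (measureReal_mono hsub (measure_ne_top _ _)) ?_
  -- marginals: the product of the gates along the root path
  set qc : ℕ → ℝ := fun i => if h : i < D then ((q (ch ⟨i, h⟩) : unitInterval) : ℝ) else 1 with hqc
  have hqc01 : ∀ i, 0 ≤ qc i ∧ qc i ≤ 1 := fun i => by
    by_cases hi : i < D
    · simp only [hqc, dif_pos hi]; exact ⟨(q _).2.1, (q _).2.2⟩
    · simp only [hqc, dif_neg hi]; norm_num
  have hpathprod : ∀ b ∈ A, (prodBernoulli w).real (openConn o b) =
      ∏ y ∈ (Finset.range (depth b + 1)).image (fun i => par^[i] b), (q y : ℝ) := by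
    intro b hbA
    have hbo : b ≠ o := hAo b hbA
    rw [tree_real_openConn_eq_prod n w o depth par hroot hstep hsupp b hbo,
      Finset.prod_image (tree_iterate_injOn o depth par hstep b hbo)]
    refine Finset.prod_congr rfl fun i hi => ?_
    have hne := (tree_iterate_par o depth par hstep b hbo i (by have := Finset.mem_range.1 hi; omega)).1
    rw [hqy _ hne]
  have hchain : ∀ m, m ≤ D →
      ∏ y ∈ ((Finset.univ : Finset (Fin D)).filter (fun i : Fin D => i.val < m)).image ch, (q y : ℝ) =
        ∏ i ∈ Finset.range m, qc i := by
    intro m hm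
    have hrange : ∏ i ∈ Finset.range m, qc i = ∏ i ∈ Finset.range D, (if i < m then qc i else 1) := by
      rw [← Finset.prod_filter]
      refine Finset.prod_congr ?_ fun _ _ => rfl
      ext i; simp only [Finset.mem_range, Finset.mem_filter]; omega
    rw [Finset.prod_image (fun i _ i' _ h => hch h), Finset.prod_filter, hrange,
      ← Fin.prod_univ_eq_prod_range (fun m' => if m' < m then qc m' else 1) D]
    refine Finset.prod_congr rfl fun i _ => ?_
    by_cases hi : (i : ℕ) < m
    · rw [if_pos hi, if_pos hi]; simp only [hqc, dif_pos i.2]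
    · rw [if_neg hi, if_neg hi]
  have hmargb : ∀ k, ∀ b ∈ R k, (prodBernoulli w).real (openConn o b) =
      (∏ i ∈ Finset.range (lv k), qc i) * ∏ e ∈ G k, (q e : ℝ) := by
    intro k b hb
    have hdisj : Disjoint (((Finset.univ : Finset (Fin D)).filter (fun i : Fin D => i.val < lv k)).image ch) (G k) := by
      rw [Finset.disjoint_left]
      intro y hy hyG
      obtain ⟨i, -, rfl⟩ := Finset.mem_image.1 hy
      exact hGch k i hyG
    rw [hpathprod b (hRA k hb), hpath k b hb, Finset.prod_union hdisj, hchain (lv k) (hlv k)]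
  have hb₁pre : b₁ ∉ ((Finset.univ : Finset (Fin D)).filter (fun i : Fin D => i.val < l)).image ch := by
    intro h; obtain ⟨i, -, hi⟩ := Finset.mem_image.1 h; exact hb₁ch i hi
  have hb₂pre : b₂ ∉ insert b₁ (((Finset.univ : Finset (Fin D)).filter (fun i : Fin D => i.val < l)).image ch) := by
    rw [Finset.mem_insert, not_or]
    refine ⟨hb.symm, fun h => ?_⟩
    obtain ⟨i, -, hi⟩ := Finset.mem_image.1 h; exact hb₂ch i hi
  have hmarg₁ : (prodBernoulli w).real (openConn o b₁) = (∏ i ∈ Finset.range l, qc i) * (q b₁ : ℝ) := by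
    rw [hpathprod b₁ hb₁A, hpath₁, Finset.prod_insert hb₁pre, hchain l hl, mul_comm]
  have hmarg₂ : (prodBernoulli w).real (openConn o b₂) =
      (∏ i ∈ Finset.range l, qc i) * ((q b₁ : ℝ) * (q b₂ : ℝ)) := by
    rw [hpathprod b₂ hb₂A, hpath₂, Finset.prod_insert hb₂pre, Finset.prod_insert hb₁pre, hchain l hl]
    ring
  -- cuts below `t`
  have hlive : ∀ k, 0 < (R k).card ↔ (R k).Nonempty := fun k => Finset.card_pos
  have htk : ∀ k, (R k).Nonempty → 1 - (∏ i ∈ Finset.range (lv k), qc i) * ∏ e ∈ G k, (q e : ℝ) ≤ t := by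
    intro k hk
    obtain ⟨b, hb'⟩ := hk
    have htb := ht b (hRA k hb')
    rw [probReal_compl_eq_one_sub (Set.toFinite _).measurableSet, hmargb k b hb'] at htb
    exact htb
  have ht' : ∀ k', 0 < a' k' →
      1 - (∏ i ∈ Finset.range (lv' k'), qc i) * ∏ e ∈ G' k', (q e : ℝ) ≤ t := by
    rintro (_ | _ | k) hk
    · exact absurd hk (lt_irrefl 0)
    · exact absurd hk (lt_irrefl 0)
    · rw [hlv'2, hG'2]
      rw [ha'2] at hk
      exact htk k ((hlive k).1 hk)
  have hthair : 1 - (∏ i ∈ Finset.range (lv' none), qc i) * ((q b₁ : ℝ) * (q b₂ : ℝ)) ≤ t := by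
    have htb := ht b₂ hb₂A
    rw [probReal_compl_eq_one_sub (Set.toFinite _).measurableSet, hmarg₂] at htb
    rw [hlv'0]
    exact htb
  have htD : 1 - (∏ i ∈ Finset.range D, qc i) ≤ t := by
    rcases hdeep with ⟨k, hk, hkD⟩ | hlD
    · have h := htk k hk
      rw [hkD] at h
      have hPle : (∏ i ∈ Finset.range D, qc i) * ∏ e ∈ G k, (q e : ℝ) ≤ ∏ i ∈ Finset.range D, qc i :=
        mul_le_of_le_one_right (Finset.prod_nonneg fun i _ => (hqc01 i).1)
          (Finset.prod_le_one (fun e _ => (q e).2.1) fun e _ => (q e).2.2)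
      linarith
    · have h := hthair
      rw [hlv'0, hlD] at h
      have hPle : (∏ i ∈ Finset.range D, qc i) * ((q b₁ : ℝ) * (q b₂ : ℝ)) ≤ ∏ i ∈ Finset.range D, qc i :=
        mul_le_of_le_one_right (Finset.prod_nonneg fun i _ => (hqc01 i).1)
          (mul_le_one₀ (q b₁).2.2 (q b₂).2.1 (q b₂).2.2)
      linarith
  -- the mean
  have hAeq : A = insert b₁ (insert b₂ ((Finset.univ : Finset κ).biUnion R)) := by
    refine Finset.Subset.antisymm (fun b hb' => ?_) ?_
    · rw [Finset.mem_insert, Finset.mem_insert]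
      rcases hcover b hb' with h | h | ⟨k, hk⟩
      · exact Or.inl h
      · exact Or.inr (Or.inl h)
      · exact Or.inr (Or.inr (Finset.mem_biUnion.2 ⟨k, Finset.mem_univ _, hk⟩))
    · refine Finset.insert_subset hb₁A (Finset.insert_subset hb₂A (Finset.biUnion_subset.2 fun k _ => hRA k))
  have hb₂U : b₂ ∉ (Finset.univ : Finset κ).biUnion R := fun h => by
    obtain ⟨k, -, hbk⟩ := Finset.mem_biUnion.1 h; exact hb₂R k hbk
  have hb₁U : b₁ ∉ insert b₂ ((Finset.univ : Finset κ).biUnion R) := by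
    rw [Finset.mem_insert, not_or]
    refine ⟨hb, fun h => ?_⟩
    obtain ⟨k, -, hbk⟩ := Finset.mem_biUnion.1 h; exact hb₁R k hbk
  have hmean : ∑ b ∈ A, (prodBernoulli w).real (openConn o b) =
      ∑ k, ((R k).card : ℝ) * ((∏ i ∈ Finset.range (lv k), qc i) * ∏ e ∈ G k, (q e : ℝ)) +
        (∏ i ∈ Finset.range l, qc i) * ((q b₁ : ℝ) + (q b₁ : ℝ) * (q b₂ : ℝ)) := by
    rw [hAeq, Finset.sum_insert hb₁U, Finset.sum_insert hb₂U,
      Finset.sum_biUnion (fun k _ k' _ hkk' => hRdisj k k' hkk'), hmarg₁, hmarg₂]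
    have hcl : ∀ k, ∑ b ∈ R k, (prodBernoulli w).real (openConn o b) =
        ((R k).card : ℝ) * ((∏ i ∈ Finset.range (lv k), qc i) * ∏ e ∈ G k, (q e : ℝ)) := by
      intro k
      rw [Finset.sum_congr rfl fun b hb' => hmargb k b hb', Finset.sum_const, nsmul_eq_mul]
    rw [Finset.sum_congr rfl fun k _ => hcl k]
    ring
  have hbudget : (2 * j : ℝ) < ∑ k', (a' k' : ℝ) *
      ((∏ i ∈ Finset.range (lv' k'), qc i) * ∏ e ∈ G' k', (q e : ℝ)) +
      (∏ i ∈ Finset.range (lv' none), qc i) * ((q b₁ : ℝ) + (q b₁ : ℝ) * (q b₂ : ℝ)) := by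
    rw [Fintype.sum_option, Fintype.sum_option]
    simp only [ha'0, ha'1, ha'2, hlv'0, hlv'2, hG'2, Nat.cast_zero, zero_mul, zero_add]
    rw [← hmean]
    exact hEN
  exact BlockCombGate.farTree_blockComb_hair q D ch hch G' hGdisj' hGch' lv' hlvle' a' j t none (some none)
    (by simp) rfl hG'0 ha'0 ha'1 b₁ b₂ hb hb₁ch hb₂ch hG₁' hG₂' hbudget ht' hthair htD

end Quant

end Summit.CriticalPhenomena.PercolationContinuityZ3.Theorems

end
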